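import Literature.MathematicalPhysics.QuantumFieldTheory.Balaban1983to89.B6SectALemma24OneLevelV1

/-!
# `Balaban1983to89.B6Lemma24TopTorusV1` — T. Bałaban, *Propagators and renormalization transformations for lattice gauge theories. II*,
# Commun. Math. Phys. **96** (1984) 223–250 [Balaban1984PropagatorsII], Lemma 2.4 (2.128) p. 245 ON THE TORUS `T^{(j)}` OF `Setup` WITH `L`-BLOCKS:
# **`(1∕(12d²))·L^{−(d+1)}·‖B‖² ≤ L^{d−2}·Σ_{c∈T^{(j+1)}} |(Q₁B)(c)|² + Σ_{p⊂T^{(j)}} |(∂₁B)(p)|²`** for every bond function `B` of `T^{(j)}` in the axial gauge of the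
# `L`-blocks — pv09's `B6Lemma24Torus.lemma24_torus` carried over the integer chart of `T^{(j)}` (the base-level-`j`, one-step edition of n10-c's C4
# `B6SectALemma24OneLevelV1`, which is the `T^{(0)}`, blocks-of-order-`k` edition), with the local form and the chart dictionary its consumers key to

statement-level skeleton of published theorems with citation tags; proofs where landed; nothing here is a claim about the Yang–Mills mass gap.

THE PRINT (verbatim).  p. 245, Lemma 2.4: *«Let a set Λ ⊂ Z^d be a sum of blocks, Λ = B(Λ′). We denote by Λ also a set of bonds b such that at least one
of the end-points b₋, b₊ belongs to Λ. Let B be a configuration defined on Λ and satisfying the condition (2.121): B(Γ_{y,x}) = 0 for x ∈ B(y), y ∈ Λ′. We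
put B = 0 outside Λ. Then the following inequality holds L^{d−2}Σ_{c∈Λ′}|(Q₁B)(c)|² + Σ_p|(∂₁B)(p)|² ≥ (1∕12d²)L^{−d−1}‖B‖². (2.128)»*; p. 249: *«Using (2.118)
and (2.128) we get ⟨B, Δ_kB⟩ ≥ (γ₀∕12d²)L^{−d−1}‖B‖² … (2.153) on the subspace of B satisfying: QB = 0, B(Γ_{y,x}) = 0 for x ∈ B(y)»*, *«on the whole lattice
T^{(k)}, or on a subset Λ ⊂ T^{(k)}»*.  [Balaban1984PropagatorsI] (1.6)–(1.8), (1.11) pp. 18–19 (blocks, contours `Γ_{y,x}`, the one-step average `Q`).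

WHY THIS FILE (cell `pub-ymgap`, D-0062; seat dag-n08-b gen 36, CLAIM-16 (B); node N06 G-B9-09 ∕ node N08 row `h324c`).  At the `k`-th step the variables
`B` of (2.152)–(2.153) and of [Balaban1985BackgroundPropagators] (3.156) live on the bonds of the UNIT lattice `T^{(k)}` and the blocks ∕ axial trees ∕
constraints `Q₁B = 0` are those of ONE more averaging step `T^{(k)} → T^{(k+1)}`; the companion `B6Ineq2118LowerMultiLevelV1` delivers the lower (2.118) for
the multi-level `Δ_k = (QGQ*)⁻¹ − a` as a bound by `Σ_{P⊂T^{(k)}}(∂B̂)(P)²` on that torus.  pv09's Lemma 2.4 is typed for periodic configurations on `ℤ^d`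
(`Cfg d`, period `M`, block `n`); C4 transported it to `Site P 0` with blocks of order `k`, n06-j localised that (`B9LocalLemma24AtLettersY`).  THIS FILE is
the transport to `Site P j` with `L`-blocks (period `M_i = sitesPerDir j`, `n = L`), i.e. Lemma 2.4 exactly where (2.153) uses it, plus the dictionary rows a
NODE-00 consumer keys to (def-Y's `labK ∕ ofZ ∕ ucorner` on `USiteY x = Site (PV …) x.k` are this file's `zlab ∕ zcast ∕ corner ∘ zlab` at `j = x.k`).
Nothing of pv09 ∕ b06 ∕ C4 is restated: `lemma24_torus`, `treeBonds`, `block`, `corner`, `q1`, `coarseSites`, `faces`, `normSqT ∕ d1SqT ∕ q1SqT` BY NAME.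

WHAT IS BUILT AND PROVED (0 `sorry`, standard axioms; four bookkeeping `def`s, everything else theorems).
* §0 `zcast j z` (`ℤ^d → T^{(j)}`, coordinates mod `sitesPerDir j`), `zlab x` (the labels in `[0, sitesPerDir j)`), `zlift B` (the periodic lift of a bond
  function of `T^{(j)}` to b06's `Cfg d`), `cornerLab y` (the labels `y_i·L` of the corner of the `L`-block `B(y)`, `y ∈ T^{(j+1)}`), `periodAt P j` (pv09's
  period vector `M_i = sitesPerDir j`).
* §1 chart lemmas (every `j`): `zcast_zlab`, `zlab_zcast_of_mem_pbox`, `zlab_mem_pbox`, `zcast_add_period`, `zcast_add_unitVec`, `zcast_add_smul_unitVec`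
  (`= runSite`), `isPeriodic_zlift`, `sum_pbox_eq_sum_site`.
* §2 one step of blocks (`j + 1 ≤ m + K`): `zlab_blockSite` (`= cornerLab y + r`), `zlab_blockSite_mem_block`, ★ `sum_block_eq_sum_offsets` (b06's
  `block L (cornerLab y)` ↔ `Site.blockSite y ·`), `cornerLab_mem_coarseSites`, ★ `sum_coarseSites_eq_sum_site` (pv09's `T′` ↔ `T^{(j+1)}`),
  `exists_eq_cornerLab`, `exists_zcast_eq_blockSite`, `blockOf_zcast_of_mem_block`, ★ `cornerLab_blockOf` (`cornerLab (blockOf u) = corner L (zlab u)` —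
  def-Y's `ucorner ∕ IsCornerY` currency).
* §3 the three terms: `normSqT_zlift` (`= Σ_b B(b)²`), `d1SqT_zlift` (`= Σ_{p : Plaq P j}(curl 1 B p)²`), `segSum_zlift`, ★ `q1_zlift` (pv09's verbatim
  (2.125) average at `(cornerLab y, μ)` IS `bondAvg B ⟨y, μ⟩` of [Balaban1984PropagatorsI] (1.11)), `q1SqT_zlift`.
* §4 ★★★ `lemma24_topTorus_faces` (Lemma 2.4 on `T^{(j)}`, `Q₁`-term in pv09's label currency, hypothesis `L ∣ sitesPerDir j`), ★★★ `lemma24_topTorus`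
  (`Q₁`-term `Σ_{c : PBond P (j+1)}(bondAvg B c)²`, `j + 1 ≤ m + K`), ★★ `lemma24_topTorus_of_q1_zero` ((2.153)'s use: `Q₁B = 0` at EVERY coarse bond ⇒
  `(1∕(12d²))L^{−(d+1)}‖B‖² ≤ Σ_p(∂B)(p)²`), `treeBond_ends_blockOf` (tree bonds lie inside their block), ★★ `lemma24_topTorus_local` (gauged on the blocks of
  a set `S ⊂ T^{(j+1)}`, VANISHING inside every other block — n06-j's local form at this level).

HONEST SCOPE.  Transport bookkeeping over landed kernel theorems; the tree hypothesis is pv09's verbatim shape `∀ y ∈ T′, ∀ b ∈ treeBonds L y, B(b) = 0`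
read through `zcast` (def-Y's `IsAxialY` = «on a comb `B9Eq3169Comb.comb L (labK x y)`» meets it through `B9Eq3169Comb.exists_mem_comb_iff`, not done
here); constants are the printed ones in V1's flat units; «`c ∈ Λ′`» in (2.128)∕(2.153) is print's STAR set (at least one end block in `Λ′`) — the
`_of_q1_zero` edition asks `Q₁B = 0` at every coarse bond of the torus, which under Dirichlet data outside `st(Λ)` is exactly that (CHECK-L of this seat,
pub-ymgap bus 2026-08-29: with both-end-good constraints only, coarse pure gauges survive).  Nothing about `U ≠ 1`, the continuum, OS or the mass gap;
count-neutral; node N06 ∕ N08 NOT discharged.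
-/

open scoped InnerProductSpace

namespace Literature.MathematicalPhysics.QuantumFieldTheory.Balaban1983to89.B6Lemma24TopTorusV1

open LatticeFieldCalculus B5Eq118OneStroke B5Eq120IterProof
open B6Lemma24Torus (IsPeriod IsPeriodic pbox mem_pbox coarseSites mem_coarseSites faces mem_faces bondsT plaqT mem_plaqT normSqT d1SqT q1SqT
  lemma24_torus)
open B6BondElimination (treeBonds mem_treeBonds unitVec unitVec_apply add_smul_unitVec_apply)
open B6SectADeltaACoerciveReductionV1 (sum_bond_eq_sum_site_dir)
open Finset

noncomputable section

variable {P : Params}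

/-! ## §0 The integer chart of `T^{(j)}` and the periodic lift of a bond function -/

/-- the periodic projection `ℤ^d → T^{(j)}`: coordinates modulo `sitesPerDir j` (C4's `castZ` at level `0`; def-Y's `ofZ` at a member's level `k`).
[cite: Balaban1987RG1, (0.1) p.251; Balaban1984PropagatorsII, (2.1) p.224, dictionary] -/
def zcast (j : ℕ) (z : Fin P.d → ℤ) : Site P j := fun i => ((z i : ℤ) : ZMod (P.sitesPerDir j))

/-- the integer labels of a site of `T^{(j)}` (the representative in `[0, sitesPerDir j)^d`; C4's `toZ`, def-Y's `labK`).
[cite: Balaban1987RG1, (0.1) p.251; Balaban1984PropagatorsII, (2.1) p.224, dictionary] -/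
def zlab {j : ℕ} (x : Site P j) : Fin P.d → ℤ := fun i => ((x i).val : ℤ)

/-- **the periodic lift** `B^ℤ(⟨z, z + e_μ⟩) := B(⟨z mod M, μ⟩)` of a bond function of `T^{(j)}` to b06's carrier `Cfg d` (pv09's «configuration on the torus»).
[cite: Balaban1984PropagatorsII, (2.152)–(2.153) p.249 («on the whole lattice T^{(k)}»), dictionary] -/
def zlift {j : ℕ} (Bk : PBond P j → ℝ) : B6TreeGaugePoincare.Cfg P.d := fun b => Bk ⟨zcast j b.1, b.2⟩

/-- the labels `y_i·L` of the CORNER of the `L`-block `B(y)`, `y ∈ T^{(j+1)}` (B5 (1.6): `B(y) = {x : y_μ ≤ x_μ < y_μ + L}` with `y` an `L`-lattice point).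
[cite: Balaban1984PropagatorsI, (1.6) p.18, dictionary] -/
def cornerLab {j : ℕ} (y : Site P (j + 1)) : Fin P.d → ℤ := fun i => (((y i).val * P.L : ℕ) : ℤ)

/-- pv09's period vector of `T^{(j)}`: `M_i = sitesPerDir j` in every direction. [cite: Balaban1987RG1, (0.1) p.251, dictionary] -/
abbrev periodAt (P : Params) (j : ℕ) : Fin P.d → ℕ := fun _ => P.sitesPerDir j

/-! ## §1 Chart lemmas -/

section Chart

variable {j : ℕ}

/-- the lift evaluated. [cite: Balaban1984PropagatorsII, (2.152) p.249, bookkeeping] -/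
@[simp] theorem zlift_apply (Bk : PBond P j → ℝ) (z : Fin P.d → ℤ) (μ : Fin P.d) : zlift Bk (z, μ) = Bk ⟨zcast j z, μ⟩ := rfl

/-- `zcast ∘ zlab = id`. [cite: Balaban1987RG1, (0.1) p.251, bookkeeping] -/
theorem zcast_zlab (x : Site P j) : zcast j (zlab x) = x := by
  funext i; simp [zcast, zlab]

/-- `zlab ∘ zcast = id` on the period box. [cite: Balaban1987RG1, (0.1) p.251, bookkeeping] -/
theorem zlab_zcast_of_mem_pbox {z : Fin P.d → ℤ} (hz : z ∈ pbox (periodAt P j)) : zlab (zcast j z) = z := by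
  funext i
  obtain ⟨h0, h1⟩ := mem_pbox.1 hz i
  simp only [zlab, zcast]
  rw [ZMod.val_intCast, Int.emod_eq_of_lt h0 h1]

/-- labels lie in the period box. [cite: Balaban1987RG1, (0.1) p.251, bookkeeping] -/
theorem zlab_mem_pbox (x : Site P j) : zlab x ∈ pbox (periodAt P j) :=
  mem_pbox.2 fun i => ⟨Int.natCast_nonneg _, Int.ofNat_lt.mpr (ZMod.val_lt (x i))⟩

/-- the projection forgets periods. [cite: Balaban1987RG1, (0.1) p.251, bookkeeping] -/
theorem zcast_add_period {z v : Fin P.d → ℤ} (hv : IsPeriod (periodAt P j) v) : zcast j (z + v) = zcast (P := P) j z := by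
  funext i
  simp only [zcast, Pi.add_apply, Int.cast_add]
  rw [(ZMod.intCast_zmod_eq_zero_iff_dvd (v i) _).2 (hv i), add_zero]

/-- `zcast (z + e_μ) = (zcast z) + e_μ`. [cite: Balaban1984PropagatorsI, (1.1)–(1.2) p.18, bookkeeping] -/
theorem zcast_add_unitVec (z : Fin P.d → ℤ) (μ : Fin P.d) : zcast (P := P) j (z + unitVec μ) = (zcast j z).shift μ := by
  funext i
  by_cases h : i = μ
  · subst h; simp [zcast, Site.shift, unitVec_apply]
  · simp [zcast, Site.shift, unitVec_apply, h]

/-- `zcast (z + t·e_μ)` is the `t`-th site of the straight contour from `zcast z` (`runSite`). [cite: Balaban1984PropagatorsI, (1.7)–(1.8) pp.18–19, bookkeeping] -/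
theorem zcast_add_smul_unitVec (z : Fin P.d → ℤ) (μ : Fin P.d) (t : ℕ) :
    zcast (P := P) j (z + (t : ℤ) • unitVec μ) = runSite (zcast j z) μ t := by
  funext i
  by_cases h : i = μ
  · subst h; simp [zcast, runSite, unitVec_apply]
  · simp [zcast, runSite, unitVec_apply, h]

/-- the lift is `M`-periodic (a torus configuration in pv09's sense). [cite: Balaban1984PropagatorsII, (2.152) p.249, bookkeeping] -/
theorem isPeriodic_zlift (Bk : PBond P j → ℝ) : IsPeriodic (periodAt P j) (zlift Bk) := by
  intro z v ν hv
  simp only [zlift_apply, zcast_add_period hv]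

/-- sums over the period box are sums over `T^{(j)}`. [cite: Balaban1987RG1, (0.1) p.251, bookkeeping] -/
theorem sum_pbox_eq_sum_site {α : Type*} [AddCommMonoid α] (f : (Fin P.d → ℤ) → α) :
    ∑ z ∈ pbox (periodAt P j), f z = ∑ x : Site P j, f (zlab x) := by
  refine Finset.sum_bij' (fun z _ => zcast j z) (fun x _ => zlab x) (fun _ _ => Finset.mem_univ _) (fun x _ => zlab_mem_pbox x)
    (fun z hz => zlab_zcast_of_mem_pbox hz) (fun x _ => zcast_zlab x) (fun z hz => ?_)
  rw [zlab_zcast_of_mem_pbox hz]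

end Chart

/-! ## §2 One step of blocks: `B(y)`, `y ∈ T^{(j+1)}`, in the chart -/

section Blocks

variable {j : ℕ}

/-- the labels of the block point with offset `r`: `cornerLab y + r` (no wrap-around in the standing range). [cite: Balaban1984PropagatorsI, (1.6) p.18, bookkeeping] -/
theorem zlab_blockSite (hj : j + 1 ≤ P.m + P.K) (y : Site P (j + 1)) (r : Fin P.d → Fin P.L) :
    zlab (Site.blockSite y r) = cornerLab y + fun i => ((r i : ℕ) : ℤ) := by
  funext i
  simp only [zlab, cornerLab, Pi.add_apply, Site.val_blockSite hj]
  push_cast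
  ring

/-- … hence they lie in b06's block over the corner labels. [cite: Balaban1984PropagatorsI, (1.6) p.18, bookkeeping] -/
theorem zlab_blockSite_mem_block (hj : j + 1 ≤ P.m + P.K) (y : Site P (j + 1)) (r : Fin P.d → Fin P.L) :
    zlab (Site.blockSite y r) ∈ B6Elimination.block P.L (cornerLab y) := by
  rw [zlab_blockSite hj, B6Elimination.mem_block]
  intro i
  have := (r i).isLt
  simp only [Pi.add_apply]
  constructor <;> omega

/-- ★ sums over b06's block `B(cornerLab y)` are sums over the offsets of `Setup`'s block `B(y)`. [cite: Balaban1984PropagatorsI, (1.6) p.18, (1.11) p.19, bookkeeping] -/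
theorem sum_block_eq_sum_offsets (hj : j + 1 ≤ P.m + P.K) {α : Type*} [AddCommMonoid α] (y : Site P (j + 1))
    (f : (Fin P.d → ℤ) → α) :
    ∑ z ∈ B6Elimination.block P.L (cornerLab y), f z = ∑ r : Fin P.d → Fin P.L, f (zlab (Site.blockSite y r)) := by
  -- the offset of a point of the block
  have hoff : ∀ z ∈ B6Elimination.block P.L (cornerLab y), ∀ i, 0 ≤ z i - cornerLab y i ∧ z i - cornerLab y i < P.L := fun z hz i => by
    obtain ⟨h0, h1⟩ := B6Elimination.mem_block.1 hz i
    constructor <;> omega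
  refine (Finset.sum_bij' (fun r _ => zlab (Site.blockSite y r))
    (fun z hz => fun i => ⟨(z i - cornerLab y i).toNat, (Int.toNat_lt (hoff z hz i).1).2 (hoff z hz i).2⟩)
    (fun r _ => zlab_blockSite_mem_block hj y r) (fun _ _ => Finset.mem_univ _) (fun r _ => ?_) (fun z hz => ?_) (fun _ _ => rfl)).symm
  · funext i
    apply Fin.ext
    simp only [zlab_blockSite hj, Pi.add_apply, add_sub_cancel_left, Int.toNat_natCast]
  · funext i
    simp only [zlab_blockSite hj, Pi.add_apply]
    rw [Int.toNat_of_nonneg (hoff z hz i).1]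
    ring

/-- corners are coarse sites of pv09's torus (`L`-lattice points of the period box). [cite: Balaban1984PropagatorsII, (2.128) p.245 («c ∈ Λ′»), bookkeeping] -/
theorem cornerLab_mem_coarseSites (hj : j + 1 ≤ P.m + P.K) (y : Site P (j + 1)) : cornerLab y ∈ coarseSites P.L (periodAt P j) := by
  refine mem_coarseSites.2 ⟨mem_pbox.2 fun i => ⟨by simp only [cornerLab]; positivity, ?_⟩, fun i => ⟨(y i).val, by simp [cornerLab, mul_comm]⟩⟩
  simp only [cornerLab, periodAt]
  have hy : (y i).val + 1 ≤ P.sitesPerDir (j + 1) := ZMod.val_lt (y i)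
  have h2 := Nat.mul_le_mul_right P.L hy
  rw [P.sitesPerDir_eq_mul_succ hj]
  push_cast
  have : ((y i).val : ℤ) * P.L + P.L ≤ (P.sitesPerDir (j + 1) : ℤ) * P.L := by exact_mod_cast (by nlinarith : (y i).val * P.L + P.L ≤ P.sitesPerDir (j + 1) * P.L)
  have hL : (0 : ℤ) < P.L := by exact_mod_cast P.L_pos
  linarith

/-- ★ sums over pv09's coarse sites `T′` are sums over `T^{(j+1)}` (the corner map is a bijection). [cite: Balaban1984PropagatorsII, (2.128) p.245 («c ∈ Λ′»), bookkeeping] -/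
theorem sum_coarseSites_eq_sum_site (hj : j + 1 ≤ P.m + P.K) {α : Type*} [AddCommMonoid α] (f : (Fin P.d → ℤ) → α) :
    ∑ y ∈ coarseSites P.L (periodAt P j), f y = ∑ y : Site P (j + 1), f (cornerLab y) := by
  classical
  let inv : (Fin P.d → ℤ) → Site P (j + 1) := fun y i => (((y i / (P.L : ℤ)).toNat : ℕ) : ZMod (P.sitesPerDir (j + 1)))
  have hL : (0 : ℤ) < P.L := by exact_mod_cast P.L_pos
  have hright : ∀ y ∈ coarseSites P.L (periodAt P j), cornerLab (inv y) = y := by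
    intro y hy
    obtain ⟨hyb, hyd⟩ := mem_coarseSites.1 hy
    funext i
    obtain ⟨h0, h1⟩ := mem_pbox.1 hyb i
    obtain ⟨q, hq⟩ := hyd i
    have hq0 : 0 ≤ q := by nlinarith
    have hqlt : q < P.sitesPerDir (j + 1) := by
      have h1' : y i < (P.sitesPerDir (j + 1) : ℤ) * (P.L : ℤ) := by
        have : ((periodAt P j i : ℕ) : ℤ) = (P.sitesPerDir (j + 1) : ℤ) * (P.L : ℤ) := by
          show ((P.sitesPerDir j : ℕ) : ℤ) = _
          rw [P.sitesPerDir_eq_mul_succ hj]; push_cast; ring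
        rw [← this]; exact h1
      rw [hq] at h1'
      nlinarith
    have hv : (inv y i).val = q.toNat := by
      simp only [inv]
      rw [hq, Int.mul_ediv_cancel_left _ hL.ne', ZMod.val_natCast, Nat.mod_eq_of_lt (by omega)]
    simp only [cornerLab]
    rw [hv]; push_cast; rw [Int.toNat_of_nonneg hq0, hq]; ring
  refine Finset.sum_bij' (fun y _ => inv y) (fun y _ => cornerLab y) (fun _ _ => Finset.mem_univ _) (fun y _ => cornerLab_mem_coarseSites hj y)
    (fun y hy => hright y hy) (fun y _ => ?_) (fun y hy => by rw [hright y hy])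
  funext i
  simp only [inv, cornerLab]
  push_cast
  rw [Int.mul_ediv_cancel _ hL.ne', Int.toNat_natCast, ZMod.natCast_zmod_val]

/-- every coarse site is the corner of a block of `T^{(j+1)}`. [cite: Balaban1984PropagatorsII, (2.128) p.245, bookkeeping] -/
theorem exists_eq_cornerLab (hj : j + 1 ≤ P.m + P.K) {y' : Fin P.d → ℤ} (hy : y' ∈ coarseSites P.L (periodAt P j)) :
    ∃ y : Site P (j + 1), cornerLab y = y' := by
  classical
  -- read off from the bijection behind `sum_coarseSites_eq_sum_site`: the indicator of `y'` has a nonzero sum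
  by_contra h
  push Not at h
  have h1 : ∑ y ∈ coarseSites P.L (periodAt P j), (if y = y' then (1 : ℕ) else 0) = 1 := by
    rw [Finset.sum_ite_eq' (coarseSites P.L (periodAt P j)) y' (fun _ => (1 : ℕ)), if_pos hy]
  rw [sum_coarseSites_eq_sum_site hj] at h1
  rw [Finset.sum_eq_zero (fun y _ => if_neg (h y))] at h1
  exact zero_ne_one h1

/-- a label of b06's block over a corner projects to a block point of `Setup`. [cite: Balaban1984PropagatorsI, (1.6) p.18, bookkeeping] -/
theorem exists_zcast_eq_blockSite (hj : j + 1 ≤ P.m + P.K) (y : Site P (j + 1)) {z : Fin P.d → ℤ}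
    (hz : z ∈ B6Elimination.block P.L (cornerLab y)) : ∃ r : Fin P.d → Fin P.L, zcast j z = Site.blockSite y r := by
  have hoff : ∀ i, 0 ≤ z i - cornerLab y i ∧ z i - cornerLab y i < P.L := fun i => by
    obtain ⟨h0, h1⟩ := B6Elimination.mem_block.1 hz i
    constructor <;> omega
  set r : Fin P.d → Fin P.L := fun i => ⟨(z i - cornerLab y i).toNat, (Int.toNat_lt (hoff i).1).2 (hoff i).2⟩ with hr
  refine ⟨r, ?_⟩
  have hz' : zlab (Site.blockSite y r) = z := by
    funext i
    simp only [zlab_blockSite hj, Pi.add_apply, hr]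
    rw [Int.toNat_of_nonneg (hoff i).1]
    ring
  rw [← zcast_zlab (Site.blockSite y r), hz']

/-- … whose block IS `y`. [cite: Balaban1984PropagatorsI, (1.6) p.18, bookkeeping] -/
theorem blockOf_zcast_of_mem_block (hj : j + 1 ≤ P.m + P.K) (y : Site P (j + 1)) {z : Fin P.d → ℤ}
    (hz : z ∈ B6Elimination.block P.L (cornerLab y)) : blockOf (zcast j z) = y := by
  obtain ⟨r, hr⟩ := exists_zcast_eq_blockSite hj y hz
  rw [hr, Site.blockOf_blockSite hj]

/-- ★ the corner of the block of a unit site in b06's `corner` currency: `cornerLab (blockOf u) = corner L (zlab u)` (def-Y's `ucorner ∕ IsCornerY` read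
`ofZ (corner L (labK ·))`). [cite: Balaban1984PropagatorsI, (1.5)–(1.6) p.18, bookkeeping] -/
theorem cornerLab_blockOf (hj : j + 1 ≤ P.m + P.K) (u : Site P j) : cornerLab (blockOf u) = B6Elimination.corner P.L (zlab u) := by
  funext i
  simp only [cornerLab, zlab, B6Elimination.corner_apply, Site.val_blockOf hj]
  push_cast
  ring

end Blocks

/-! ## §3 The three terms of (2.128) for the lift of a level-`j` bond function -/

section Terms

variable {j : ℕ}

/-- `‖B^ℤ‖²_T = Σ_b B(b)²`. [cite: Balaban1984PropagatorsII, (2.128) p.245, (2.153) p.249] -/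
theorem normSqT_zlift (Bk : PBond P j → ℝ) : normSqT (periodAt P j) (zlift Bk) = ∑ b : PBond P j, Bk b ^ 2 := by
  rw [normSqT, B6Lemma24Torus.bondsT, Finset.sum_product, sum_pbox_eq_sum_site, sum_bond_eq_sum_site_dir]
  refine Finset.sum_congr rfl fun x _ => Finset.sum_congr rfl fun μ _ => ?_
  simp only [zlift_apply, zcast_zlab]

/-- `Σ_{p⊂T}(∂₁B^ℤ)(p)² = Σ_{p : Plaq P j}(curl 1 B p)²` (b06's `curl` and `LatticeFieldCalculus.curl` are the same circulation). [cite: Balaban1984PropagatorsI, (1.2) p.18; Balaban1984PropagatorsII, (2.128) p.245] -/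
theorem d1SqT_zlift (Bk : PBond P j → ℝ) :
    d1SqT (periodAt P j) (zlift Bk) = ∑ p : Plaq P j, LatticeFieldCalculus.curl 1 Bk p ^ 2 := by
  rw [d1SqT]
  refine Finset.sum_bij' (fun q hq => (⟨zcast j q.1, q.2.1, q.2.2, (mem_plaqT.1 hq).2⟩ : Plaq P j)) (fun p _ => (zlab p.src, p.μ, p.ν))
    (fun _ _ => Finset.mem_univ _) (fun p _ => mem_plaqT.2 ⟨zlab_mem_pbox _, p.hμν⟩) (fun q hq => ?_) (fun p _ => ?_) (fun q hq => ?_)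
  · obtain ⟨z, i, μ⟩ := q
    simp only [zlab_zcast_of_mem_pbox (mem_plaqT.1 hq).1]
  · obtain ⟨x, i, μ, h⟩ := p
    simp only [zcast_zlab]
  · simp only [B6TreeGaugePoincare.curl, LatticeFieldCalculus.curl, zlift_apply, zcast_add_unitVec, one_smul]

/-- the straight-contour sums agree. [cite: Balaban1984PropagatorsI, (1.8) p.19, (1.11) p.19] -/
theorem segSum_zlift (Bk : PBond P j → ℝ) (z : Fin P.d → ℤ) (μ : Fin P.d) (n : ℕ) :
    B6Lemma24PrintedShape.segSum n (zlift Bk) z μ = segSum Bk (zcast j z) μ n := by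
  simp only [B6Lemma24PrintedShape.segSum, segSum, runBond, zlift_apply, zcast_add_smul_unitVec]

/-- ★ **`(Q₁B^ℤ)(c) = (QB)(c)`**: pv09's verbatim (2.125) average at the coarse bond `(cornerLab y, μ)` is r18's one-step average `bondAvg B ⟨y, μ⟩` of
[Balaban1984PropagatorsI] (1.11). [cite: Balaban1984PropagatorsII, (2.125) p.245; Balaban1984PropagatorsI, (1.11) p.19] -/
theorem q1_zlift (hj : j + 1 ≤ P.m + P.K) (Bk : PBond P j → ℝ) (y : Site P (j + 1)) (μ : Fin P.d) :
    B6Lemma24PrintedShape.q1 P.L (zlift Bk) (cornerLab y, μ) = bondAvg Bk ⟨y, μ⟩ := by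
  rw [B6Lemma24PrintedShape.q1, bondAvg, smul_eq_mul, Finset.mul_sum,
    sum_block_eq_sum_offsets hj y (fun z => ((P.L : ℝ) ^ (P.d + 1))⁻¹ * B6Lemma24PrintedShape.segSum P.L (zlift Bk) z μ)]
  refine Finset.sum_congr rfl fun r _ => ?_
  rw [segSum_zlift, zcast_zlab]

/-- `Σ_{c∈T′}(Q₁B^ℤ)(c)² = Σ_{c : PBond P (j+1)}(QB)(c)²`. [cite: Balaban1984PropagatorsII, (2.128) p.245; Balaban1984PropagatorsI, (1.11) p.19] -/
theorem q1SqT_zlift (hj : j + 1 ≤ P.m + P.K) (Bk : PBond P j → ℝ) :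
    q1SqT P.L (periodAt P j) (zlift Bk) = ∑ c : PBond P (j + 1), bondAvg Bk c ^ 2 := by
  rw [q1SqT, B6Lemma24Torus.faces, Finset.sum_product, sum_coarseSites_eq_sum_site hj, sum_bond_eq_sum_site_dir]
  refine Finset.sum_congr rfl fun y _ => Finset.sum_congr rfl fun μ _ => ?_
  rw [q1_zlift hj]

end Terms

/-! ## §4 ★★★ Lemma 2.4 (2.128) on `T^{(j)}` with `L`-blocks -/

section Lemma24

variable {j : ℕ}

/-- ★★★ **LEMMA 2.4 (2.128) ON `T^{(j)}` WITH `L`-BLOCKS, `Q₁`-TERM IN LABEL CURRENCY**: for `d ≥ 2`, `L ∣ sitesPerDir j` and every bond function `B` of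
`T^{(j)}` vanishing on the tree bonds of every `L`-block ((2.121), read through `zcast`),
`(1∕(12d²))·(L^{d+1})⁻¹·Σ_b B(b)² ≤ L^{d−2}·Σ_{c∈T′}(Q₁B)(c)² + Σ_{p⊂T^{(j)}}(∂B)(p)²` — pv09's `lemma24_torus` for the periodic lift.
[cite: Balaban1984PropagatorsII, Lemma 2.4 (2.128) p.245, (2.121) p.244, (2.153) p.249] -/
theorem lemma24_topTorus_faces (hd : 2 ≤ P.d) (hLM : P.L ∣ P.sitesPerDir j) (Bk : PBond P j → ℝ)
    (hT : ∀ y ∈ coarseSites P.L (periodAt P j), ∀ b ∈ treeBonds P.L y, Bk ⟨zcast j b.1, b.2⟩ = 0) :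
    1 / (12 * (P.d : ℝ) ^ 2) * ((P.L : ℝ) ^ (P.d + 1))⁻¹ * ∑ b : PBond P j, Bk b ^ 2 ≤
      (P.L : ℝ) ^ (P.d - 2) * q1SqT P.L (periodAt P j) (zlift Bk) + ∑ p : Plaq P j, LatticeFieldCalculus.curl 1 Bk p ^ 2 := by
  have hL : 1 ≤ P.L := P.L_pos
  have hM : ∀ i : Fin P.d, 0 < periodAt P j i := fun _ => Nat.pos_of_ne_zero (P.sitesPerDir_ne_zero j)
  have hLM' : ∀ i : Fin P.d, P.L ∣ periodAt P j i := fun _ => hLM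
  have hT' : ∀ y ∈ coarseSites P.L (periodAt P j), ∀ b ∈ treeBonds P.L y, zlift Bk b = 0 := fun y hy b hb => hT y hy b hb
  have h := lemma24_torus hd hL hM hLM' (zlift Bk) (isPeriodic_zlift Bk) hT'
  rw [normSqT_zlift, d1SqT_zlift] at h
  have hLr : (0 : ℝ) ≤ (P.L : ℝ) := Nat.cast_nonneg _
  have e1 : (P.L : ℝ) ^ (-((P.d : ℝ) + 1)) = ((P.L : ℝ) ^ (P.d + 1))⁻¹ := by
    rw [Real.rpow_neg hLr, ← Nat.cast_succ, Real.rpow_natCast]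
  have e2 : (P.L : ℝ) ^ ((P.d : ℝ) - 2) = (P.L : ℝ) ^ (P.d - 2) := by
    have h2 : ((P.d - 2 : ℕ) : ℝ) = (P.d : ℝ) - 2 := by rw [Nat.cast_sub hd]; norm_num
    rw [← h2, Real.rpow_natCast]
  rw [e1, e2] at h
  exact h

/-- ★★★ **LEMMA 2.4 (2.128) ON `T^{(j)}` WITH `L`-BLOCKS** (`j + 1 ≤ m + K`): same, with the `Q₁`-term read as `Σ_{c : PBond P (j+1)}(QB)(c)²` on the next torus.
[cite: Balaban1984PropagatorsII, Lemma 2.4 (2.128) p.245, (2.121) p.244; Balaban1984PropagatorsI, (1.11) p.19] -/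
theorem lemma24_topTorus (hd : 2 ≤ P.d) (hj : j + 1 ≤ P.m + P.K) (Bk : PBond P j → ℝ)
    (hT : ∀ y ∈ coarseSites P.L (periodAt P j), ∀ b ∈ treeBonds P.L y, Bk ⟨zcast j b.1, b.2⟩ = 0) :
    1 / (12 * (P.d : ℝ) ^ 2) * ((P.L : ℝ) ^ (P.d + 1))⁻¹ * ∑ b : PBond P j, Bk b ^ 2 ≤
      (P.L : ℝ) ^ (P.d - 2) * ∑ c : PBond P (j + 1), bondAvg Bk c ^ 2 + ∑ p : Plaq P j, LatticeFieldCalculus.curl 1 Bk p ^ 2 := by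
  have hLM : P.L ∣ P.sitesPerDir j := by rw [P.sitesPerDir_eq_mul_succ hj]; exact Dvd.intro_left _ rfl
  have h := lemma24_topTorus_faces hd hLM Bk hT
  rwa [q1SqT_zlift hj] at h

/-- ★★ **THE (2.153) USE OF LEMMA 2.4**: on the subspace «`QB = 0`» — `(Q₁B)(c) = 0` at EVERY coarse bond of the torus (print's STAR set; under Dirichlet
data outside `st(Λ)` the bonds with no end block in `Λ′` are automatic) — and «`B(Γ_{y,x}) = 0`», `(1∕(12d²))·(L^{d+1})⁻¹·‖B‖² ≤ Σ_{p⊂T^{(j)}}(∂B)(p)²`.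
[cite: Balaban1984PropagatorsII, (2.153) p.249, Lemma 2.4 (2.128) p.245] -/
theorem lemma24_topTorus_of_q1_zero (hd : 2 ≤ P.d) (hLM : P.L ∣ P.sitesPerDir j) (Bk : PBond P j → ℝ)
    (hT : ∀ y ∈ coarseSites P.L (periodAt P j), ∀ b ∈ treeBonds P.L y, Bk ⟨zcast j b.1, b.2⟩ = 0)
    (hQ : ∀ c ∈ faces P.L (periodAt P j), B6Lemma24PrintedShape.q1 P.L (zlift Bk) c = 0) :
    1 / (12 * (P.d : ℝ) ^ 2) * ((P.L : ℝ) ^ (P.d + 1))⁻¹ * ∑ b : PBond P j, Bk b ^ 2 ≤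
      ∑ p : Plaq P j, LatticeFieldCalculus.curl 1 Bk p ^ 2 := by
  have h := lemma24_topTorus_faces hd hLM Bk hT
  have h0 : q1SqT P.L (periodAt P j) (zlift Bk) = 0 := by
    rw [q1SqT]
    exact Finset.sum_eq_zero fun c hc => by rw [hQ c hc, zero_pow two_ne_zero]
  rwa [h0, mul_zero, zero_add] at h

/-- the two end points of a tree bond of `B(y)` lie in `B(y)` (n06-j's `ends_mem_iterBlock_of_treeBond` at this level). [cite: Balaban1984PropagatorsII, (2.121) p.244; Balaban1984PropagatorsI, (1.7) p.18, bookkeeping] -/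
theorem treeBond_ends_blockOf (hj : j + 1 ≤ P.m + P.K) (y : Site P (j + 1)) {b : (Fin P.d → ℤ) × Fin P.d}
    (hb : b ∈ treeBonds P.L (cornerLab y)) : blockOf (zcast j b.1) = y ∧ blockOf ((zcast j b.1).shift b.2) = y := by
  obtain ⟨hb1, hb2, hb3⟩ := mem_treeBonds.1 hb
  refine ⟨blockOf_zcast_of_mem_block hj y hb1, ?_⟩
  rw [← zcast_add_unitVec]
  refine blockOf_zcast_of_mem_block hj y (B6Elimination.mem_block.2 fun i => ?_)
  obtain ⟨h0, h1⟩ := B6Elimination.mem_block.1 hb1 i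
  rw [Pi.add_apply, unitVec_apply]
  split_ifs with h
  · subst h; constructor <;> omega
  · constructor <;> omega

/-- ★★ **LEMMA 2.4 ON `T^{(j)}`, LOCAL FORM**: for `B` gauged on the blocks of a set `S ⊂ T^{(j+1)}` and VANISHING on every bond inside every other block
(then (2.121) holds on all blocks), the inequality of `lemma24_topTorus`. [cite: Balaban1984PropagatorsII, Lemma 2.4 (2.128) p.245 («We put B = 0 outside Λ»), (2.121) p.244] -/
theorem lemma24_topTorus_local (hd : 2 ≤ P.d) (hj : j + 1 ≤ P.m + P.K) (Bk : PBond P j → ℝ) (S : Set (Site P (j + 1)))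
    (hT : ∀ y ∈ S, ∀ b ∈ treeBonds P.L (cornerLab y), Bk ⟨zcast j b.1, b.2⟩ = 0)
    (hoff : ∀ y, y ∉ S → ∀ b : PBond P j, blockOf b.src = y → blockOf b.tgt = y → Bk b = 0) :
    1 / (12 * (P.d : ℝ) ^ 2) * ((P.L : ℝ) ^ (P.d + 1))⁻¹ * ∑ b : PBond P j, Bk b ^ 2 ≤
      (P.L : ℝ) ^ (P.d - 2) * ∑ c : PBond P (j + 1), bondAvg Bk c ^ 2 + ∑ p : Plaq P j, LatticeFieldCalculus.curl 1 Bk p ^ 2 := by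
  classical
  refine lemma24_topTorus hd hj Bk fun y' hy' b hb => ?_
  obtain ⟨y, rfl⟩ := exists_eq_cornerLab hj hy'
  by_cases hS : y ∈ S
  · exact hT y hS b hb
  · obtain ⟨h1, h2⟩ := treeBond_ends_blockOf hj y hb
    exact hoff y hS ⟨zcast j b.1, b.2⟩ h1 h2

end Lemma24

end

end Literature.MathematicalPhysics.QuantumFieldTheory.Balaban1983to89.B6Lemma24TopTorusV1
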